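import Literature.AlgebraicGeometry.ComplexMultiplication.AndreProductFormHolds
import Literature.AlgebraicGeometry.HodgeTheory.WeilClassesCMReductionGalois
import Literature.AlgebraicGeometry.HodgeTheory.HodgeClassesIsogenyInvariance
import HarnessLib

/-!
# Milne 2020, proof of Theorem 1 — the carrier lemmas «relative to `F`»: Galois CM field polynomials of an integral
# separating element, and the `F`-Weil lines lie in `W_F ⊗ ℂ`

The universe-free part of the Literature-side proof of Milne 2020 Thm. 1 (= André 1992) and of André's theorem in split
and weak form (records `HodgeTheory.Milne2020_hodgeClasses_cmType_mem_span_pullback_weilClassesField_galois`,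
`HodgeTheory.Andre1992_hodgeClasses_cmType_mem_span_pullback_splitWeilClassesCM`,
`HodgeTheory.Andre1992_hodgeClasses_cmAbelianVariety_mem_span_pullback_weilClasses`), on the record's carriers
`weilClassesField B ψ P (2p)`:

* § GaloisCMPoly (`K` a number field, `a₀ ∈ 𝓞_K`): `minpoly_ℤ(a₀)` mapped to `ℚ` (`minpoly_int_map_eq`); every complex
  root of it is `σ(a₀)` for an embedding `σ` when `a₀` separates the embeddings (`exists_embedding_of_root`); every
  element of `K` is a rational polynomial in `a₀` (`exists_aeval_eq_of_separating`); and for `K` a GALOIS CM field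
  `minpoly_ℤ(a₀)` is a Galois CM field polynomial in the record's sense (`isGaloisCMFieldPoly_minpoly`: no real root,
  complex conjugation induced by one `Q ∈ ℚ[T]`, every root a `ℚ`-polynomial in every other).
* § WeilLines (a finite biproduct `⨁ B` with `𝓞_K`-actions `act_j`): with `ψ :=` the diagonal action of `a₀` and
  `P := minpoly_ℤ(a₀)`, the `K`-Weil lines of `AndreProductForm` lie in `weilClassesField` (`weilLineClasses_le_weilClassesField`)
  and `P(ψ) = 0` (`eval₂_diagHom_minpoly`) — «relative to `F`» in Milne's proof, `F = ℚ(a₀)`.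

Everything is linear algebra / field theory; no case of the Hodge conjecture is asserted.

Provenance: Literature home (namespace `Literature.AlgebraicGeometry.ComplexMultiplication.Milne2020`) of §§ GaloisCMPoly and
WeilLines of the Summits-side `CorCM/Milne2020OfRiemann` (the universe-dependent assembly there is not re-homed); imports
`Literature/` and Mathlib only. Lane `lit-hodgefound` (Layer A3/A4), seat p20.

## References
* [Milne2020HodgeClassesAV] J. S. Milne, *Hodge classes on abelian varieties* (2020), §3 Thm. 1 and proof.
* [Andre1992HodgeCM] Y. André, *Une remarque à propos des cycles de Hodge de type CM* (1992), Théorème.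
* [Deligne1982HodgeCycles] P. Deligne (notes by J. S. Milne), LNM 900 (1982), §4 Prop. 4.4, §5, endnote M.12.
* [MoonenZarhin1998WeilClasses] B. Moonen, Yu. Zarhin, J. reine angew. Math. 496 (1998), §1.
-/

noncomputable section

namespace Literature.AlgebraicGeometry.ComplexMultiplication.Milne2020

open _root_.CategoryTheory _root_.CategoryTheory.Limits NumberField Polynomial
open Literature.AlgebraicGeometry Literature.AlgebraicGeometry.Motives Literature.AlgebraicGeometry.HodgeTheory
open Literature.AlgebraicGeometry.ComplexMultiplication Literature.AlgebraicGeometry.Milne1999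
open Literature.NumberTheory.Automorphic
open Literature.AlgebraicGeometry.ComplexMultiplication.AndreProductForm

section GaloisCMPoly

variable (K : Type) [Field K] [NumberField K]

/-- `minpoly_ℤ(a₀)` maps to `minpoly_ℚ(a₀)` (integrally closed base). [cite: Milne2020HodgeClassesAV, §3 Thm. 1 (proof), auxiliary step] -/
theorem minpoly_int_map_eq (a₀ : 𝓞 K) :
    (minpoly ℤ a₀).map (Int.castRingHom ℚ) = minpoly ℚ (a₀ : K) := by
  have hintK : IsIntegral ℤ (a₀ : K) := RingOfIntegers.isIntegral_coe a₀
  have heq : minpoly ℤ (a₀ : K) = minpoly ℤ a₀ :=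
    minpoly.algebraMap_eq (IsFractionRing.injective (𝓞 K) K) a₀
  rw [← heq, ← algebraMap_int_eq, ← minpoly.isIntegrallyClosed_eq_field_fractions' ℚ hintK]

/-- Every complex root of `minpoly_ℤ(a₀)` is `σ(a₀)` for a complex embedding `σ` of `K`. [cite: Milne2020HodgeClassesAV, §3 Thm. 1 (proof), auxiliary step] -/
theorem exists_embedding_of_root (a₀ : 𝓞 K) {ρ : ℂ}
    (hρ : Polynomial.eval₂ (Int.castRingHom ℂ) ρ (minpoly ℤ a₀) = 0) :
    ∃ σ : K →+* ℂ, σ (a₀ : K) = ρ := by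
  have hmem : ρ ∈ (minpoly ℚ (a₀ : K)).rootSet ℂ := by
    rw [Polynomial.mem_rootSet]
    refine ⟨minpoly.ne_zero (Algebra.IsIntegral.isIntegral (R := ℚ) (a₀ : K)), ?_⟩
    have h2 : Polynomial.eval₂ (Int.castRingHom ℂ) ρ (minpoly ℤ a₀) =
        Polynomial.aeval ρ ((minpoly ℤ a₀).map (Int.castRingHom ℚ)) := by
      rw [Polynomial.aeval_def, Polynomial.eval₂_map]
      congr 1
    rw [← minpoly_int_map_eq, ← h2, hρ]
  rw [← NumberField.Embeddings.range_eval_eq_rootSet_minpoly K ℂ (a₀ : K)] at hmem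
  exact hmem

/-- A separating element generates `K` over `ℚ`: every element of `K` is a `ℚ`-polynomial in `a₀`.
 [cite: Milne2020HodgeClassesAV, §3 Thm. 1 (proof), auxiliary step] -/
theorem exists_aeval_eq_of_separating (a₀ : 𝓞 K)
    (hsep : Function.Injective fun σ : K →+* ℂ => σ (a₀ : K)) (x : K) :
    ∃ R : Polynomial ℚ, Polynomial.aeval (a₀ : K) R = x := by
  have hprim : IntermediateField.adjoin ℚ {(a₀ : K)} = ⊤ := by
    rw [Field.primitive_element_iff_algHom_eq_of_eval' ℚ ℂ (fun x => IsAlgClosed.splits _) (a₀ : K)]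
    intro φ ψ h
    have h' : (φ : K →+* ℂ) = (ψ : K →+* ℂ) := hsep h
    exact AlgHom.coe_ringHom_injective h'
  have hx : x ∈ (IntermediateField.adjoin ℚ {(a₀ : K)}).toSubalgebra := by
    rw [hprim]; trivial
  rw [IntermediateField.adjoin_simple_toSubalgebra_of_isAlgebraic
      (Algebra.IsAlgebraic.isAlgebraic (R := ℚ) (a₀ : K)), Algebra.adjoin_singleton_eq_range_aeval] at hx
  obtain ⟨R, hR⟩ := hx
  exact ⟨R, hR⟩

/-- Evaluating a rational polynomial at `σ(a₀)` is applying `σ` to its value at `a₀`. [cite: Milne2020HodgeClassesAV, §3 Thm. 1 (proof), auxiliary step] -/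
theorem eval₂_embedding_eq (σ : K →+* ℂ) (x : K) (R : Polynomial ℚ) :
    Polynomial.eval₂ (algebraMap ℚ ℂ) (σ x) R = σ (Polynomial.aeval x R) := by
  rw [← Polynomial.aeval_def]
  exact Polynomial.aeval_algHom_apply σ.toRatAlgHom x R

variable [IsCMField K] [IsGalois ℚ K]

/-- **The minimal polynomial of an integer `a₀` of a Galois CM field `K` separating the complex embeddings
is a Galois CM field polynomial of degree `[K:ℚ]`** in the sense of the record
(`HodgeTheory.IsGaloisCMFieldPoly`): monic, of degree `[K:ℚ] ≥ 2`, irreducible over `ℚ`, no real complex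
root (`K` is totally complex and `σ ↦ σ(a₀)` is injective), ONE `Q ∈ ℚ[T]` inducing complex conjugation on
every root (`c(a₀) = Q(a₀)` for the complex conjugation `c` of the CM field `K = ℚ(a₀)`, and
`σ ∘ c = conj ∘ σ` for every `σ`), and every root a `ℚ`-polynomial in every other (`K/ℚ` Galois: two
embeddings differ by an automorphism `g`, and `g(a₀) = R(a₀)`). [cite: Milne2020HodgeClassesAV, §3 (proof of Thm. 1: "Let F be a CM subfield of ℂ, Galois over ℚ")] -/
theorem isGaloisCMFieldPoly_minpoly (a₀ : 𝓞 K)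
    (hsep : Function.Injective fun σ : K →+* ℂ => σ (a₀ : K)) :
    IsGaloisCMFieldPoly (minpoly ℤ a₀) (Module.finrank ℚ K) := by
  obtain ⟨hPm, hPirr, hPe, hroot, -⟩ := minpoly_facts K a₀ hsep
  refine ⟨hPm, hPe, ?_, hPirr, ?_, ?_, ?_⟩
  · -- `2 ≤ [K:ℚ]`: `K` is totally complex, so `[K:ℚ] = 2 · #(complex places) > 0`
    have h1 := IsTotallyComplex.finrank (K := K)
    have h2 : 0 < Module.finrank ℚ K := Module.finrank_pos
    omega
  · -- no real root
    intro ρ hρ hconj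
    obtain ⟨σ, rfl⟩ := exists_embedding_of_root K a₀ hρ
    refine IsTotallyComplex.complexEmbedding_not_isReal σ (ComplexEmbedding.isReal_iff.mpr (hsep ?_))
    change ComplexEmbedding.conjugate σ (a₀ : K) = σ (a₀ : K)
    rw [ComplexEmbedding.conjugate_coe_eq]
    exact hconj
  · -- one rational polynomial inducing complex conjugation on all the roots
    obtain ⟨Q, hQ⟩ := exists_aeval_eq_of_separating K a₀ hsep (IsCMField.complexConj K (a₀ : K))
    refine ⟨Q, fun ρ hρ => ?_⟩
    obtain ⟨σ, rfl⟩ := exists_embedding_of_root K a₀ hρ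
    rw [eval₂_embedding_eq, hQ, IsCMField.complexEmbedding_complexConj]
  · -- Galois: every root is a rational polynomial in every other
    intro ρ ρ' hρ hρ'
    obtain ⟨σ, rfl⟩ := exists_embedding_of_root K a₀ hρ
    obtain ⟨σ', rfl⟩ := exists_embedding_of_root K a₀ hρ'
    obtain ⟨R, hR⟩ := exists_aeval_eq_of_separating K a₀ hsep ((galOf K σ σ') (a₀ : K))
    refine ⟨R, ?_⟩
    rw [eval₂_embedding_eq, hR]
    have h := congrArg (fun f : K →+* ℂ => f (a₀ : K)) (comp_galOf K σ σ')
    exact h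

end GaloisCMPoly

section WeilLines

variable (K : Type) [Field K] [NumberField K]
variable {J : Type} [Fintype J] (B : J → AbelianVariety ℂ) (act : ∀ j, 𝓞 K →+* End (B j))

/-- **`K`-Weil-line classes are Weil classes of `F = ℚ(a₀)` on the carriers of the record**: for the
diagonal action `act` of `𝓞_K` on `⨁ B` and any `a₀ ∈ 𝓞_K`, the space `weilLineClasses B act k`
lies in `weilClassesField (⨁ B) ψ P k`, `ψ = act(a₀)`, `P = minpoly_ℤ(a₀)` (`(x·𝟙 + y·ψ)^* = act(x + y a₀)^*`
acts on the `s`-line by `(x + y s(a₀))^k`; the inclusion inside `AndreProductForm.eq_zero_of_not_admissible`).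
[cite: MoonenZarhin1998WeilClasses, §1 (W_F ⊗ ℂ = ⊕_σ ⋀^r V_{ℂ,σ})] [cite: Milne2020HodgeClassesAV, §2 2.1] -/
theorem weilLineClasses_le_weilClassesField (a₀ : 𝓞 K) (k : ℕ) :
    weilLineClasses B act k ≤ weilClassesField (⨁ B) (diagHom K B act a₀) (minpoly ℤ a₀) k := by
  have hroot : ∀ σ : K →+* ℂ, Polynomial.eval₂ (Int.castRingHom ℂ) (σ (a₀ : K)) (minpoly ℤ a₀) = 0 := by
    intro σ
    have h1 : Polynomial.aeval (σ.toRatAlgHom (a₀ : K)) (minpoly ℚ (a₀ : K)) = 0 := by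
      rw [Polynomial.aeval_algHom_apply, minpoly.aeval, map_zero]
    have h2 : Polynomial.eval₂ (Int.castRingHom ℂ) (σ (a₀ : K)) (minpoly ℤ a₀) =
        Polynomial.aeval (σ (a₀ : K)) ((minpoly ℤ a₀).map (Int.castRingHom ℚ)) := by
      rw [Polynomial.aeval_def, Polynomial.eval₂_map]
      congr 1
    rw [h2, minpoly_int_map_eq]
    exact h1
  unfold weilLineClasses
  refine iSup_le fun s => ?_
  refine le_trans ?_ (pullbackEigenclasses_le_weilClassesField (hroot s))
  intro x hx
  rw [mem_pullbackEigenclasses_iff]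
  intro x' y'
  have hx' := (Submodule.mem_iInf _).mp hx ((x' : 𝓞 K) + (y' : 𝓞 K) * a₀)
  rw [Module.End.mem_eigenspace_iff] at hx'
  rw [nsmul_id_add_nsmul_diagHom]
  change (complexBetti.map (diagonalAction B act ((x' : 𝓞 K) + (y' : 𝓞 K) * a₀)).hom.hom.hom k).hom x = _
  rw [hx']
  congr 1
  simp

omit [NumberField K] in
/-- `P(ψ) = 0` in `End(⨁ B)` for `ψ = act(a₀)`, `P = minpoly_ℤ(a₀)`. [cite: Milne2020HodgeClassesAV, §3 Thm. 1 (proof), auxiliary step] -/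
theorem eval₂_diagHom_minpoly (a₀ : 𝓞 K) :
    Polynomial.eval₂ (Int.castRingHom (CategoryTheory.End (⨁ B)))
      (diagHom K B act a₀ : CategoryTheory.End (⨁ B)) (minpoly ℤ a₀) = 0 := by
  have hPa₀ : Polynomial.eval₂ (Int.castRingHom (𝓞 K)) a₀ (minpoly ℤ a₀) = 0 := by
    have := minpoly.aeval ℤ a₀
    rwa [Polynomial.aeval_def, algebraMap_int_eq] at this
  change Polynomial.eval₂ _ (diagEnd K B act a₀) _ = 0
  rw [eval₂_diagEnd, hPa₀, map_zero]

end WeilLines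
end Literature.AlgebraicGeometry.ComplexMultiplication.Milne2020

end
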